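import Literature.MathematicalPhysics.QuantumFieldTheory.Balaban1983to89.B9Ineq373L2Letters
import Literature.MathematicalPhysics.QuantumFieldTheory.Balaban1983to89.B9Ineq363L2

/-!
# `Balaban1983to89.B9Ineq385L2V3` — [Balaban1985BackgroundPropagators] (3.85) p. 407 IN THE BLOCK-`ℓ²` CURRENCY OF (3.46), THE `V₃(A)` THIRD:
# `conj b V₃(A) · G(U) ≺₂ O(1)B₀α₁e^{−ρd}` from Theorem 3.3's `L²` members (3.46)₀,₁ at U and the `ℓ²` sizes of the letters of `V₃(A)`
# (`B9Ineq373L2Letters`) — second brick of the kernel-free `ℓ²` route to the (3.46) members of `G(U′U)` displayed in `B9SectBStepFrameV4.SectBFrame₄`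

T. Bałaban, *Propagators for lattice gauge theories in a background field*, Commun. Math. Phys. **99** (1985) 389–434
[`Balaban1985BackgroundPropagators`, "B9"]; [4] = T. Bałaban, *Propagators and renormalization transformations for lattice gauge theories. II*,
Commun. Math. Phys. **96** (1984) 223–250 [`Balaban1984PropagatorsII`].

statement-level skeleton of published theorems with citation tags; proofs where landed; nothing here is a claim about the Yang–Mills mass gap

THE PRINTED LOCUS (verbatim).  p. 407: *"Δ_a(U′U) = Δ_a(U) − V₃(A) − P₁(A) − P₂(A). (3.82) The operator V₃(A) is a local differential operator of the
first order satisfying the bound (3.73). … Let us denote the sum of these three operators by V(A). … Using the bounds (3.73), (3.77), (3.83) and assuming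
that Theorem 3.3 holds for G(U), we get |(V(A)G(U)J)(b)| ≤ O(1)α₁e^{−(1/2)δ₀d(y,y′)}|J| for b ∈ Δ(y), supp J ⊂ Δ(y′). (3.85) … Theorem (3.3) implies
also convergence in all norms appearing in its formulation, thus in all norms on the left-hand sides of the inequalities (3.42)–(3.47). This way we get
all these inequalities for the operator G(U′U), the local ones follow from the bound (3.85) and Lemma 2.1 [4]."*

WHY THIS FILE (pub-ymgap N06 row 13, seat dag-n06-c g5).  The six (3.46) member-steps of `G(U′U)` displayed in `SectBFrame₄.stepL2G` need (3.85) in the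
block-`ℓ²` form (the sup form (3.85) does not control `L²` block norms without a volume factor — the cell's dead end «sup-(3.63) + sup|λ| ≦ ‖λ‖₂»).
`V(A) = V₃(A) + P₁(A) + P₂(A)`; THIS FILE does the LOCAL third `V₃(A)`: the generic first-order device `B9Ineq363L2.ineq363_op_sum_l2` (this seat, g4)
on the bond carrier, fed with r06's gradient form `B9Eq382V3Letters.conj_V₃Op_eq_gradForm`, the `ℓ²` letter sizes `B9Ineq373L2Letters.
hasL2Majorant_V₃_zero ∕ _one`, and Theorem 3.3's `L²` members (3.46)₀ (`G ≺₂ B₀(Lʲη)²e^{−δd}`) and (3.46)₁ (`∇_kG ≺₂ B₀Lʲη e^{−δd}` per concrete bond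
difference letter) AS HYPOTHESES.  The `ℓ²` twin of the `V₃`-part of r06's `B9Ineq385KernelConcrete` ∕ `B9Ineq386CommSum.ineq385_op_sum` (sup), same
letters, same non-propagator hypotheses.

WHAT IS PROVED (one theorem; 0 sorry; standard axioms; no definition): ★★ `ineq385_l2_V3G` — `conj b (V₃Op η A) · G ≺₂ θ₃·e^{−ρd(y,y′)}` with
`θ₃ = 2B₀Λc₁(β)·(c⁰_V(d,α₁,C₀) + 28d(d+1))·M₂(Σ‖b_i‖)√(N#ι)e^{δd₀}·α₁` EXPLICIT (`N = |κ|(1+2|κ|+2|κ|²)`), for every rate `ρ ≧ 0` with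
`ρ + (α+β)δ₀ ≦ δ`.

NOT HERE (successor bricks): the `P₂(A)` third (products of the averaging letters `Q, Q*, F₂, F₂*` and the weight `a` — needs their `ℓ²` sizes as
readings), the `P₁(A)` third (the (3.49)-entries of `P(U) = I − R(U)` and the (3.68)-entries of `P′(A)` in `ℓ²` through the site lattice — an `ℓ²`
Hom-majorant calculus), the assembly (3.85)₂ and the extension entries of `G(U′U)` (generic bricks `B9Ineq363L2.hasL2Majorant_leftEntry_gpExt`,
`B9Ineq363L2Right.hasL2Majorant_rightEntry_gpExt` apply verbatim once (3.85)₂ is in hand).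

HONEST SCOPE.  Finite-dimensional bookkeeping over r06's concrete letters; Theorem 3.3 at U is the INPUT; nothing of [B9] is asserted for Bałaban's
propagators; count-neutral; NOT a node discharge; nothing continuum ∕ OS ∕ mass-gap ∕ Clay.  Cell `pub-ymgap` (HUMAN RULING D-0062), Track A node N06 [B9],
N06-ASSIGNMENT row 13, seat `pub-ymgap-dag-n06-c` (g5), 2026-08-27.
-/

noncomputable section

open scoped BigOperators

namespace Literature.MathematicalPhysics.QuantumFieldTheory.Balaban1983to89.B9Ineq385L2V3

open NormedSpace Complex
open Literature.MathematicalPhysics.QuantumFieldTheory.Balaban1983to89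
open Literature.MathematicalPhysics.QuantumFieldTheory.Balaban1983to89.B6RandomWalk (Triangle254 Ineq261)
open Literature.MathematicalPhysics.QuantumFieldTheory.Balaban1983to89.B6RandomWalkL2 (HasL2Majorant hasL2Majorant_mono)
open Literature.MathematicalPhysics.QuantumFieldTheory.Balaban1983to89.B9Thm34Ext (toB6)
open Literature.MathematicalPhysics.QuantumFieldTheory.Balaban1983to89.B9Ineq347 (ScaleTransfer)
open Literature.MathematicalPhysics.QuantumFieldTheory.Balaban1983to89.B9Eq39Adjoint
open Literature.MathematicalPhysics.QuantumFieldTheory.Balaban1983to89.B9Eq369Small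
open Literature.MathematicalPhysics.QuantumFieldTheory.Balaban1983to89.B9Eq372Locality (stBonds)
open Literature.MathematicalPhysics.QuantumFieldTheory.Balaban1983to89.B9Eq375Locality (locBondsA locBondsA')
open Literature.MathematicalPhysics.QuantumFieldTheory.Balaban1983to89.B9Eq373V3 (kΔ)
open Literature.MathematicalPhysics.QuantumFieldTheory.Balaban1983to89.B9Eq352DivForm (tauF tauB)
open Literature.MathematicalPhysics.QuantumFieldTheory.Balaban1983to89.B9Eq352DivFormLetters (conj)
open Literature.MathematicalPhysics.QuantumFieldTheory.Balaban1983to89.B9Eq352GradLetters (diffLetter conj_add)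
open Literature.MathematicalPhysics.QuantumFieldTheory.Balaban1983to89.B9Eq371GradLetters (bT bU V1Letter)
open Literature.MathematicalPhysics.QuantumFieldTheory.Balaban1983to89.B9Eq375GradLetters (V1Letter₂)
open Literature.MathematicalPhysics.QuantumFieldTheory.Balaban1983to89.B9Eq382V3Letters (V₃Op cV0 conj_V₃Op_eq_gradForm)
open Literature.MathematicalPhysics.QuantumFieldTheory.Balaban1983to89.B9Ineq363L2 (ineq363_op_sum_l2)
open Literature.MathematicalPhysics.QuantumFieldTheory.Balaban1983to89.B9Ineq373L2Letters (hasL2Majorant_V₃_one hasL2Majorant_V₃_zero)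

variable {𝔸 : Type*} [NormedRing 𝔸] [NormedAlgebra ℂ 𝔸] [CompleteSpace 𝔸] {ι : Type} [Fintype ι] [DecidableEq ι]
variable (b : Module.Basis ι ℝ 𝔸) {S : Type} [Fintype S] [DecidableEq S] {κ : Type} [Fintype κ] [LinearOrder κ]
variable (T : κ → Equiv.Perm S) (U : κ → S → 𝔸ˣ)
variable {g : B9.Geometry} [Fintype g.Site] {Rr : ℝ} {H : Prop}

/-- ★★ **(3.85) IN THE BLOCK-`ℓ²` FORM, THE `V₃(A)` THIRD** («The operator V₃(A) is a local differential operator of the first order satisfying the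
bound (3.73) … assuming that Theorem 3.3 holds for G(U), we get |(V(A)G(U)J)(b)| ≦ O(1)α₁e^{−(1/2)δ₀d(y,y′)}|J|», read in the `L²` norms of (3.46)
«convergence in all norms appearing in its formulation»): after real coordinates on the bond carrier, `conj b V₃(A) · G(U) ≺₂ θ₃·e^{−ρd}` with
`θ₃ = 2B₀Λc₁(β)·(c⁰_V(d,α₁,C₀) + 28d(d+1))·M₂(Σ‖b_i‖)√(N#ι)e^{δd₀}·α₁` EXPLICIT.  INPUTS: a group-valued background, (3.35) on the plaquettes
through each bond at that bond's block scale, (3.37) read blockwise for the letters of `V₃(A)` as r06's sup programme reads them, `η·α₁(Lʲη)⁻¹ ≦ 1/4`,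
the stencil geometry at range `d₀`, the coordinate bound `M₂`; THEOREM 3.3 FOR `G(U)` IN ITS `L²` FORM: (3.46)₀ `G ≺₂ B₀(Lʲη)²e^{−δd}` and (3.46)₁
`∇_kG ≺₂ B₀Lʲη e^{−δd}` for each concrete bond difference letter `k ∈ κ ⊕ κ`; Lemma 2.1 of [4] (scale transfers of `Lʲη`, `(Lʲη)²` at `α`, (2.61) at `β`,
(2.54)); rate `ρ ≧ 0` with `ρ + (α+β)δ₀ ≦ δ`.  The device is `B9Ineq363L2.ineq363_op_sum_l2` on `conj_V₃Op_eq_gradForm`.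
[cite: Balaban1985BackgroundPropagators, (3.82)–(3.85) p.407 + (3.73) p.405 + Thm 3.3 p.399 + (3.46) p.398; Balaban1984PropagatorsII, Lemma 2.1 p.234 + Prop. 2.6 (2.140)–(2.141) p.247] -/
theorem ineq385_l2_V3G (blk : S → g.Site) (d : ℕ) (hη : 0 < g.eta) (hL : 1 ≤ g.L) (A : κ → S → 𝔸) (C₀ d₀ M₂ : ℝ)
    (δ₀ δ α β ρ Λ B₀ α₁ : ℝ)
    (hB₀ : 0 ≤ B₀) (hα₁ : 0 ≤ α₁) (hΛ : 0 ≤ Λ) (hρ : 0 ≤ ρ) (hα : 0 ≤ α) (hβ : 0 ≤ β) (hδ₀ : 0 ≤ δ₀) (hδ : 0 ≤ δ)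
    (hr : ρ + (α + β) * δ₀ ≤ δ) (hC₀ : 0 ≤ C₀) (hM₂ : 0 ≤ M₂) (hrepr : ∀ (v : 𝔸) (i : ι), |b.repr v i| ≤ M₂ * ‖v‖)
    (hdnn : ∀ a a' : g.Site, 0 ≤ g.dist a a') (htri : Triangle254 (toB6 g Rr H)) (hlen : ∀ y : g.Site, 0 < g.len y)
    (h261 : Ineq261 d (toB6 g Rr H) δ₀ β)
    (hT1 : ScaleTransfer g δ₀ α Λ (fun a => g.len a)) (hT2 : ScaleTransfer g δ₀ α Λ (fun a => g.len a ^ 2))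
    (hsmall : ∀ y : g.Site, g.eta * (α₁ * (g.len y)⁻¹) ≤ 1 / 4)
    (hU1 : ∀ m z, ‖((U m z : 𝔸ˣ) : 𝔸)‖ ≤ 1 ∧ ‖(((U m z)⁻¹ : 𝔸ˣ) : 𝔸)‖ ≤ 1)
    -- (3.37) for the exponent field, blockwise, in the shapes the letters of `V₃(A)` read it
    (hA : ∀ k x, ‖A k x‖ ≤ α₁ * (g.len (blk x))⁻¹) (hAτB : ∀ ν k x, ‖tauB T U ν (A k) x‖ ≤ α₁ * (g.len (blk x))⁻¹)
    (hAτF : ∀ μ k x, ‖tauF T U μ (A k) x‖ ≤ α₁ * (g.len (blk x))⁻¹)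
    (h337B : ∀ ν k x, ‖((g.eta : ℂ)⁻¹) • covDstar T U ν (A k) x‖ ≤ α₁ * (g.len (blk x) ^ 2)⁻¹)
    (h337F : ∀ μ ν x, ‖((g.eta : ℂ)⁻¹) • covD T U μ (A ν) x‖ ≤ α₁ * (g.len (blk x) ^ 2)⁻¹)
    (h337B' : ∀ μ ν x, ‖((g.eta : ℂ)⁻¹) • covDstar T U ν (A ν) (T μ x)‖ ≤ α₁ * (g.len (blk x) ^ 2)⁻¹)
    (hAst : ∀ μ x m z, (m, z) ∈ stBonds T μ x → ‖A m z‖ ≤ α₁ * (g.len (blk x))⁻¹)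
    (hAloc : ∀ μ x m z, (m, z) ∈ locBondsA T μ x → ‖A m z‖ ≤ α₁ * (g.len (blk x))⁻¹)
    (hdAst : ∀ μ x m n y, Through T μ x m n y →
      ‖covD T U m (A n) y‖ ≤ g.eta * (α₁ * ((g.len (blk x))⁻¹) ^ 2) ∧
        ‖covD T U n (A m) y‖ ≤ g.eta * (α₁ * ((g.len (blk x))⁻¹) ^ 2))
    (h35 : ∀ μ x m n y, Through T μ x m n y → ‖(plaqU T U m n y : 𝔸) - 1‖ ≤ C₀ * ((g.L ^ g.scale (blk x))⁻¹) ^ 2)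
    -- stencil geometry at range `d₀`
    (hd₀B : ∀ μ x, g.dist (blk x) (blk ((T μ).symm x)) ≤ d₀) (hd₀F : ∀ μ x, g.dist (blk x) (blk (T μ x)) ≤ d₀)
    (hd₀FB : ∀ μ ν x, g.dist (blk x) (blk ((T ν).symm (T μ x))) ≤ d₀)
    (hd₀st : ∀ μ x (q : κ × S), q ∈ stBonds T μ x → g.dist (blk x) (blk q.2) ≤ d₀)
    (hd₀loc : ∀ μ x (q : κ × S), q ∈ locBondsA' T μ x → g.dist (blk x) (blk q.2) ≤ d₀)
    (hd₀0 : ∀ y : g.Site, g.dist y y ≤ d₀)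
    -- THEOREM 3.3 FOR `G(U)` IN ITS `L²` FORM: (3.46)₀,₁ on the bond carrier
    {G : Module.End ℝ ((κ × S) × ι → ℝ)}
    (h346_0 : HasL2Majorant (g := toB6 g Rr H) (fun q : (κ × S) × ι => blk q.1.2) G
      (fun a a' => B₀ * g.len a ^ 2 * Real.exp (-(δ * g.dist a a'))))
    (h346_1 : ∀ k : κ ⊕ κ, HasL2Majorant (g := toB6 g Rr H) (fun q : (κ × S) × ι => blk q.1.2)
      (conj b (diffLetter (bT T) (bU U) ((g.eta : ℂ)⁻¹) k) * G) (fun a a' => B₀ * g.len a * Real.exp (-(δ * g.dist a a')))) :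
    HasL2Majorant (g := toB6 g Rr H) (fun q : (κ × S) × ι => blk q.1.2)
      (conj b (V₃Op T U g.eta A) * G)
      (fun a a' => (2 * B₀ * Λ * B6.c1 d δ₀ β *
          ((cV0 (Fintype.card κ) α₁ C₀ + 28 * Fintype.card κ * (Fintype.card κ + 1)) * M₂ * (∑ i, ‖b i‖) *
            Real.sqrt (((Fintype.card κ * (1 + 2 * Fintype.card κ + 2 * Fintype.card κ ^ 2)) * Fintype.card ι : ℕ) : ℝ) *
            Real.exp (δ * d₀))) *
        α₁ * Real.exp (-(ρ * g.dist a a'))) := by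
  have hSb : 0 ≤ ∑ i, ‖b i‖ := Finset.sum_nonneg fun i _ => norm_nonneg _
  have hE₀ : 0 ≤ Real.exp (δ * d₀) := Real.exp_nonneg _
  have hd : (0 : ℝ) ≤ Fintype.card κ := Nat.cast_nonneg _
  set sN : ℝ := Real.sqrt (((Fintype.card κ * (1 + 2 * Fintype.card κ + 2 * Fintype.card κ ^ 2)) * Fintype.card ι : ℕ) : ℝ) with hsN
  have hsN0 : 0 ≤ sN := Real.sqrt_nonneg _
  have hcV00 : 0 ≤ cV0 (Fintype.card κ) α₁ C₀ := by
    have := B9Eq382V3Operator.kΔ_nonneg hα₁ hC₀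
    have := B9Eq372RemLetters.growth_nonneg (s := (1 : ℝ) / 4) (by norm_num)
    unfold cV0; positivity
  -- the zeroth-order constant and the coefficient constant of the letters file
  set c0L : ℝ := cV0 (Fintype.card κ) α₁ C₀ * M₂ * (∑ i, ‖b i‖) * sN * Real.exp (δ * d₀) with hc0L
  set c1L : ℝ := 14 * (Fintype.card κ + 1) * M₂ * (∑ i, ‖b i‖) * sN * Real.exp (δ * d₀) with hc1L
  set cV : ℝ := (cV0 (Fintype.card κ) α₁ C₀ + 28 * Fintype.card κ * (Fintype.card κ + 1)) * M₂ * (∑ i, ‖b i‖) * sN *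
    Real.exp (δ * d₀) with hcV_def
  have hc0L0 : 0 ≤ c0L := by rw [hc0L]; positivity
  have hc1L0 : 0 ≤ c1L := by rw [hc1L]; positivity
  have hcV_eq : cV = c0L + 2 * Fintype.card κ * c1L := by rw [hcV_def, hc0L, hc1L]; ring
  have hcV : 0 ≤ cV := by rw [hcV_eq]; positivity
  -- `hV0` in L² at the larger constant `cV`
  have hV0 : HasL2Majorant (g := toB6 g Rr H) (fun q : (κ × S) × ι => blk q.1.2)
      (conj b (B9Eq371GradLetters.zeroLetter T U ((g.eta : ℂ)⁻¹) A + B9Eq372RemLetters.F₁Letter T U g.eta A)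
        - conj b (B9Eq382V3Letters.dPrimeLetter T (prodCfg U g.eta A) g.eta - B9Eq382V3Letters.dPrimeLetter T U g.eta)
        + conj b (B9Eq375GradLetters.zeroLetter₂ T U ((g.eta : ℂ)⁻¹) A + B9Eq372RemLetters.F₂Letter T U g.eta A))
      (fun y y' => cV * α₁ * (g.len y ^ 2)⁻¹ * Real.exp (-(δ * g.dist y y'))) := by
    refine hasL2Majorant_mono (g := toB6 g Rr H) _
      (hasL2Majorant_V₃_zero (Rr := Rr) (H := H) b T U blk hη hL A C₀ d₀ δ M₂ α₁ hα₁ hC₀ hδ hM₂ hrepr hlen hsmall hU1 h337B h337F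
        h337B' hAst hAloc hdAst h35 hd₀B hd₀F hd₀FB hd₀st hd₀loc hd₀0) fun y y' => ?_
    change g.Site at y y'
    have hw2 : 0 ≤ (g.len y ^ 2)⁻¹ := inv_nonneg.mpr (sq_nonneg _)
    have hε : 0 ≤ Real.exp (-(δ * g.dist y y')) := Real.exp_nonneg _
    have hle : c0L ≤ cV := by rw [hcV_eq]; nlinarith
    have : c0L * α₁ * (g.len y ^ 2)⁻¹ * Real.exp (-(δ * g.dist y y')) ≤ cV * α₁ * (g.len y ^ 2)⁻¹ * Real.exp (-(δ * g.dist y y')) := by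
      gcongr
    simpa only [hc0L, hsN] using this
  have h := ineq363_op_sum_l2 (R := Rr) (H := H) (fun q : (κ × S) × ι => blk q.1.2) d (Finset.univ : Finset (κ ⊕ κ)) δ₀ δ α β ρ Λ
    B₀ cV α₁ (fun _ => c1L) hB₀ hcV hα₁ hΛ hρ hα hβ hδ₀ hr (fun _ _ => hc1L0) ?_ hdnn htri hlen h261 hT1 hT2
    (V1 := fun k => conj b (V1Letter T U A k) + conj b (V1Letter₂ T U A k))
    (D := fun k => conj b (diffLetter (bT T) (bU U) ((g.eta : ℂ)⁻¹) k))
    (conj_V₃Op_eq_gradForm T U b g.eta A) hV0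
    (fun k _ => by
      simpa only [hc1L, hsN] using hasL2Majorant_V₃_one (Rr := Rr) (H := H) b T U blk A d₀ δ M₂ α₁ hα₁ hδ hM₂ hrepr hlen hA hAτB
        hAτF hU1 hd₀B hd₀F hd₀0 k)
    h346_0 (fun k _ => h346_1 k)
  · simpa only [hcV_def, hsN] using h
  · rw [Finset.sum_const, Finset.card_univ, Fintype.card_sum, nsmul_eq_mul, Nat.cast_add, hcV_eq]
    have : ((Fintype.card κ : ℕ) : ℝ) + (Fintype.card κ : ℕ) = 2 * Fintype.card κ := by ring
    rw [this]
    nlinarith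

end Literature.MathematicalPhysics.QuantumFieldTheory.Balaban1983to89.B9Ineq385L2V3
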